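import Summits.QuantumFields.BalabanUV.Beta.GAN24.ExitChargeParityBase
import Summits.QuantumFields.BalabanUV.Beta.GAN24.ConstraintHessianPointInversion

/-!
# `BalabanUV.Beta.GAN24.ExitChargeParityTower` — binder row G-an2-4 ∕ (CONV-C), the (S) row of RULING R-gan24p1-g27-1 PART B (viii), sub-step (INV-X) ∕ (INV-Z),
# FIELD HALF, EVERY LEVEL: **THE PARITY TOWER — the exit⊗exit charge function of the pure S table is ODD under the point inversion of its slot at EVERY level;
# hence road-P2 g39's `hZS` for the consumer's class, and (INV-X-geo) AT THE CENTRED ROOT WITH NO DISPLAYED HYPOTHESIS**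

NOT IN PRINT; OUR BOOKKEEPING ([folklore] by name: (I1) `ChargeTowerStep.hasSum_prod_coordWeighted_SpureRecAt_succ_inl_inl` + `tsum_weighted_vertexOfK` (road-P2 g41), (W)
`ChargeTowerInduction.exitWt_blk_eq` (road-P2 g42), leaf-02 g57 PART D `SrecChargeLamDropsAllLevels.tsum_prod_exitWt_srecAt_eq_spureRecAt`, this seat's
`CoDressedColumnPointInversion.colH_pointInv_ctr_gen` ((INV-G), general centre), `ExitChargeParityBase` (level 0) and `ConstraintHessianPointInversion` §5 (the consumer modulo `hZS`);
0 `def`, 0 cited fact, 0 `def … : Prop`, 0 sorry).  HONEST FRAMING (cell contract, verbatim): «discharging `BetaPertH` makes Bałaban's UV stability UNCONDITIONAL — a real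
constructive-QFT result; it is NOT the continuum limit and NOT the Clay problem.»  HONEST DEPENDENCY (verbatim): «continuum YM on T⁴ ⇐ BetaPertH ∧ nine spine estimates (0/9 proved);
BetaPertH ⇐ (D1) ∧ (D4) ∧ CAP+tail; G-an2-4 gates asym, D1 and NE2/3/4.»

WHAT (centred root `ρ = toSite (ctrOff (d+1) Lc)`, `Lc` odd, all `cE cVH cΛ`, ALL directions `α β`; `𝟙^{exit,N}_a(x) := [x_a % N = N − 1]`; the exit⊗exit CHARGE FUNCTION of level `j`
at period `N`: `C^N_j(κ, u) := Σ'_{(x,z)} 𝟙^{exit,N}_α(x)·𝟙^{exit,N}_β(z)·SpureRecAt … j κ u x z (inl α)(inl β)`; centres `c^N_t := N•t + (N−1)•𝟙`, `t` ANY integer vector):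
* §1 `exitCharge_succ_eq_colH_read` ((I1) IN CHARGE-FUNCTION FORM, any in-block root: `C^N_{j+1}(κ′, v) = A_j·Σ_κ Σ'_u colH G_j Lc κ′ v κ u·C^{Lc·N}_j(κ, u)`, `A_j = (cE·wE_{j+1})·cH_j²`
  — the vertex unfolded by `tsum_weighted_vertexOfK`, PART D full → pure, (W) for the pulled-back weight) and **`exitCharge_pointInv_succ`** (THE RUNG): IF
  `C^{Lc·N}_j(κ, c^{Lc·N}_t − e_κ − u) = −C^{Lc·N}_j(κ, u)` for all slots, THEN `C^N_{j+1}(κ′, c^N_t − e_κ′ − u′) = −C^N_{j+1}(κ′, u′)` for all slots — the slot `c^N_t − e_κ′ − u′` is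
  the coarse bond inverted through `c^N_t∕2`, and `colH_pointInv_ctr_gen` (centre vector `c^N_t`) moves the inversion onto the fine leg as `u ↦ c^{Lc·N}_t − e_κ − u`
  (`Lc•c^N_t + (Lc−1)•𝟙 = c^{Lc·N}_t`); re-index, apply the hypothesis.
* §2 **`exitCharge_spureRecAt_pointInv`** (induction on `j`, `N ↦ Lc·N` in the hypothesis, base = `ExitChargeParityBase.exitCharge_spureRecAt_zero_pointInv`): for EVERY `j`, EVERY
  `N ≥ 1`, every `t`, every slot: `C^{Lc·N}_j(κ, c^{Lc·N}_t − e_κ − u) = −C^{Lc·N}_j(κ, u)`; **`exitCharge_spureRecAt_succ_pointInv`** (levels `≥ 1`, EVERY period `N ≥ 1`, incl.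
  `N = Lc` = the pure exit class and `N = 1` = the plain class).
* §3 THE CONSUMER: **`tsum_exitWt_spureRecAt_slotInv_ctr`** = road-P2 g39's `hZS` LITERALLY at the centred root for `ω = (p₁·𝟙^{exit,Lc}_{κ₀}) ⊗ (p₂·𝟙^{exit,Lc}_{κ₀′})` — RULING
  R-gan24p1-g28-1 (ii)'s transported currency `u_a ⊗ u_b = Lc⁻²exit ⊗ Lc⁻²exit` — with `t = −1`, `ω′ = ω`, every label `y`, level `j+1`, slot; hence
  **`weightedCharge_rotatedVertex_slotInv_ctr_exit`** and **`weightedProfile_comb_slotInv_ctr_exit`**: road-P2's (INV-X-geo) theorems AT THE CENTRED ROOT IN THE (S) ROW's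
  CURRENCY WITH NO DISPLAYED HYPOTHESIS — (INV-G) by `CoDressedColumnPointInversion`, `hZM` by `ConstraintHessianPointInversion`, `hZS` by §2: the ω-charge of `(α)_y` at the
  inverted slot `(ν, 2•y − e_ν − y′)` is MINUS the ω-charge of `(α⁺)_y` at `(ν, y′)`, `ε = −1` (road-P2 E26: «s = s′ = +1, t = −1 ⇒ ε = −1»); and in `tsum` form
  **`tsum_weightedCharge_rotatedVertex_slotInv_ctr_exit`** — the literal `hgeo : Vα (2•y − e_ν − y′) = ε·V⁺ y′` of road-P2's `tsum_slotMoment_pair_eq_zero`, no hypothesis.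
READING.  RULING R-gan24p1-g28-1 (i) split PART B (viii) as (INV-X-geo) ∘ (W-γ); (INV-X-geo) is now a THEOREM at the centred root for the consumer's class (the OWNER's (iv): «the
(INV) mechanism is about the CENTRED root»); what remains of the (S) row's (INV)_{α+γ} is (W-γ) «(γ)(e) = −(α⁺)(e)» (road-P2 ∕ leaf-06) and (M0).  What this file does NOT do:
(W-γ); the plain ∕ mixed components `q ≠ 0` of `span{1, exit} ⊗ span{1, exit}` in the consumer corollary (the plain sub-row is road-P2 g40's (T-F)); off-centre roots; entry ∕
slab classes; anything of (Q-R) ∕ (LT) ∕ (Q-L) ∕ (C) ∕ «T2Shape» ∕ (hW, hWall).  Asserts NO value of Bałaban's tables; NEVER «G-an2-4 closed» as (CONV-C); NOT D1, NOT `BetaPertH`,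
NOT continuum, NOT Clay.  2026-08-22 (gan24-formalise-leaf-02 gen 58); no existing file touched.
-/

noncomputable section

open Finset
open scoped BigOperators
open Literature.MathematicalPhysics.QuantumFieldTheory
open Literature.MathematicalPhysics.QuantumFieldTheory.Balaban1983to89
open Literature.MathematicalPhysics.QuantumFieldTheory.Balaban1983to89.Beta
open ExpKernelCalculus (Site MKer)
open AffineAveraging (Form1 box toSite unitVec unitVec_apply)
open AveragingContours (blk)
open AveragingContoursRooted (ctrOff ctrOff_mem_box)
open OneStepResolventKernel (Fib)
open OneStepKernelFamily (KInvStep colH vertexOfK)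
open SecondOrderResponse (colM dM)
open BalabanStepJetsSucc (wE)
open Summit.QuantumFields.BalabanUV.Beta.BorderedHessian (stepScale diagK)
open Summit.QuantumFields.BalabanUV.Beta.ChartConjugation (conjV)
open Summit.QuantumFields.BalabanUV.Beta.AveragingWardRootedStencils (legInd)
open Summit.QuantumFields.BalabanUV.Beta.AxialDressingRooted (coDressKBmAt one_le_of_neZero decays_coDressKBmAt_KInvStep)
open Summit.QuantumFields.BalabanUV.Beta.SpineRooted (SpureRecAt M1At)
open Summit.QuantumFields.BalabanUV.Beta.WardLocusRecursive (SrecAt locStencil_SrecAt)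
open Summit.QuantumFields.BalabanUV.Beta.GAN24.SrecChargeLamDropsAllLevels (tsum_prod_exitWt_srecAt_eq_spureRecAt)
open Summit.QuantumFields.BalabanUV.Beta.GAN24.ChargeTowerStep (hasSum_prod_coordWeighted_SpureRecAt_succ_inl_inl tsum_weighted_vertexOfK)
open Summit.QuantumFields.BalabanUV.Beta.GAN24.ChargeTowerClimb (ite_and_mul_eq)
open Summit.QuantumFields.BalabanUV.Beta.GAN24.ChargeTowerInduction (exitWt_blk_eq abs_exitInd_le_one)
open Summit.QuantumFields.BalabanUV.Beta.GAN24.CoDressedColumnPointInversion (colH_pointInv_ctr_gen)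
open Summit.QuantumFields.BalabanUV.Beta.GAN24.WardResidualRotatedVertexInversion (hasSum_weighted_rotatedVertexEnd_comb)
open Summit.QuantumFields.BalabanUV.Beta.GAN24.ConstraintHessianPointInversion (weightedProfile_comb_slotInv_ctr_spanExit weightedCharge_rotatedVertex_slotInv_ctr_spanExit)
open Summit.QuantumFields.BalabanUV.Beta.GAN24.ExitChargeParityBase (exitCharge_spureRecAt_zero_pointInv)

namespace Summit.QuantumFields.BalabanUV.Beta.GAN24.ExitChargeParityTower

variable {d : ℕ} {Lc : ℕ} [NeZero Lc]

/-! ## §1 The rung: parity climbs one level through (I1) and the column covariance (INV-G) -/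

/-- NOT IN PRINT; OUR BOOKKEEPING.  **(I1) IN CHARGE-FUNCTION FORM** (centred root would not be needed here: any in-block root `r`; all `cE cVH cΛ`, every `j`, every period
`N ≥ 1`, every slot `(κ′, v)`): `C^N_{j+1}(κ′, v) = (cE·wE_{j+1})·cH_j²·Σ_κ Σ'_u colH G_j Lc κ′ v κ u·C^{Lc·N}_j(κ, u)` — the level-`(j+1)` exit⊗exit charge function at period `N`
is the `ℋ`-column read of the level-`j` one at period `Lc·N` ((I1) ⨾ `tsum_weighted_vertexOfK` ⨾ PART D ⨾ (W)). -/
theorem exitCharge_succ_eq_colH_read {r : Fin (d + 1) → ℕ} (hr : r ∈ box (d + 1) Lc) (cE cVH cΛ : ℝ) (j : ℕ) (α β : Fin (d + 1)) {N : ℕ} (hN : 1 ≤ N)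
    (κ' : Fin (d + 1)) (v : Site (d + 1)) :
    ∑' xz : Site (d + 1) × Site (d + 1),
        (if xz.1 α % (N : ℤ) = (N : ℤ) - 1 then (1 : ℝ) else 0) * (if xz.2 β % (N : ℤ) = (N : ℤ) - 1 then (1 : ℝ) else 0)
          * SpureRecAt d Lc (toSite r) cE cVH cΛ (j + 1) κ' v xz.1 xz.2 (Sum.inl α) (Sum.inl β)
      = (cE * wE d Lc (j + 1)) * ((stepScale d Lc j * (Lc : ℝ) ^ (d + 1))⁻¹ ^ 2 *
        ∑ κ : Fin (d + 1), ∑' u : Site (d + 1), colH (coDressKBmAt (toSite r) Lc (KInvStep (d := d) Lc j)) Lc κ' v κ u *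
          ∑' yw : Site (d + 1) × Site (d + 1),
            (if yw.1 α % ((Lc * N : ℕ) : ℤ) = ((Lc * N : ℕ) : ℤ) - 1 then (1 : ℝ) else 0) * (if yw.2 β % ((Lc * N : ℕ) : ℤ) = ((Lc * N : ℕ) : ℤ) - 1 then (1 : ℝ) else 0)
              * SpureRecAt d Lc (toSite r) cE cVH cΛ j κ u yw.1 yw.2 (Sum.inl α) (Sum.inl β)) := by
  classical
  have hLc : 1 ≤ Lc := one_le_of_neZero Lc
  -- (I1) with `f₁ = f₂ = 𝟙^{exit,N}`
  have h1 := (hasSum_prod_coordWeighted_SpureRecAt_succ_inl_inl hr cE cVH cΛ j κ' v α β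
    (fun s : ℤ => if s % (N : ℤ) = (N : ℤ) - 1 then (1 : ℝ) else 0) (fun s : ℤ => if s % (N : ℤ) = (N : ℤ) - 1 then (1 : ℝ) else 0)
    (fun s => abs_exitInd_le_one _ s) (fun s => abs_exitInd_le_one _ s)).tsum_eq
  rw [h1]
  congr 2
  -- unfold the vertex under the two pulled-back weights
  obtain ⟨δ, C, hδ, -, hG⟩ := decays_coDressKBmAt_KInvStep (d := d) hr j
  obtain ⟨Cs, δs, hδs, hS⟩ := locStencil_SrecAt (d := d) (Lc := Lc) hLc hr cE cVH cΛ j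
  have hg : ∀ y : Site (d + 1), |(if y α % (Lc : ℤ) = (Lc : ℤ) - 1 then (if blk Lc y α % (N : ℤ) = (N : ℤ) - 1 then (1 : ℝ) else 0) else 0)| ≤ 1 := fun y => by
    split_ifs <;> simp
  have hg' : ∀ w : Site (d + 1), |(if w β % (Lc : ℤ) = (Lc : ℤ) - 1 then (if blk Lc w β % (N : ℤ) = (N : ℤ) - 1 then (1 : ℝ) else 0) else 0)| ≤ 1 := fun w => by
    split_ifs <;> simp
  have h2 := tsum_weighted_vertexOfK hLc hG hδ hS hδs κ' v
    (fun y : Site (d + 1) => if y α % (Lc : ℤ) = (Lc : ℤ) - 1 then (if blk Lc y α % (N : ℤ) = (N : ℤ) - 1 then (1 : ℝ) else 0) else 0)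
    (fun w : Site (d + 1) => if w β % (Lc : ℤ) = (Lc : ℤ) - 1 then (if blk Lc w β % (N : ℤ) = (N : ℤ) - 1 then (1 : ℝ) else 0) else 0) hg hg' (Sum.inl α) (Sum.inl β)
  have e1 : ∀ yw : Site (d + 1) × Site (d + 1),
      (if yw.1 α % (Lc : ℤ) = (Lc : ℤ) - 1 ∧ yw.2 β % (Lc : ℤ) = (Lc : ℤ) - 1 then
          (if blk Lc yw.1 α % (N : ℤ) = (N : ℤ) - 1 then (1 : ℝ) else 0) * (if blk Lc yw.2 β % (N : ℤ) = (N : ℤ) - 1 then (1 : ℝ) else 0) *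
            vertexOfK (coDressKBmAt (toSite r) Lc (KInvStep (d := d) Lc j)) Lc (SrecAt d Lc (toSite r) cE cVH cΛ j) κ' v yw.1 yw.2 (Sum.inl α) (Sum.inl β)
        else 0)
      = (if yw.1 α % (Lc : ℤ) = (Lc : ℤ) - 1 then (if blk Lc yw.1 α % (N : ℤ) = (N : ℤ) - 1 then (1 : ℝ) else 0) else 0)
        * vertexOfK (coDressKBmAt (toSite r) Lc (KInvStep (d := d) Lc j)) Lc (SrecAt d Lc (toSite r) cE cVH cΛ j) κ' v yw.1 yw.2 (Sum.inl α) (Sum.inl β)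
        * (if yw.2 β % (Lc : ℤ) = (Lc : ℤ) - 1 then (if blk Lc yw.2 β % (N : ℤ) = (N : ℤ) - 1 then (1 : ℝ) else 0) else 0) := fun yw => ite_and_mul_eq _ _ _ _ _
  simp only [e1]
  rw [h2]
  refine Finset.sum_congr rfl fun κ _ => ?_
  refine tsum_congr fun u => ?_
  congr 1
  -- PART D (full → pure) and (W) (pulled-back weight = product-period weight)
  rw [tsum_prod_exitWt_srecAt_eq_spureRecAt hLc hr cE cVH cΛ j
    (f₁ := fun s : ℤ => if s % (N : ℤ) = (N : ℤ) - 1 then (1 : ℝ) else 0) (f₂ := fun s : ℤ => if s % (N : ℤ) = (N : ℤ) - 1 then (1 : ℝ) else 0)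
    (fun s => abs_exitInd_le_one _ s) (fun s => abs_exitInd_le_one _ s) κ u α β]
  refine tsum_congr fun yw => ?_
  rw [exitWt_blk_eq hLc hN yw.1 α, exitWt_blk_eq hLc hN yw.2 β]

/-- NOT IN PRINT; OUR BOOKKEEPING.  **THE RUNG OF THE PARITY TOWER** (centred root, `Lc` odd, all `cE cVH cΛ`, ALL `α β`, every `j`, every period `N ≥ 1`, every integer vector `t`):
IF the level-`j` exit⊗exit charge function at period `Lc·N` is odd under the slot inversion with centre `c^{Lc·N}_t = (Lc·N)•t + (Lc·N − 1)•𝟙`, THEN the level-`(j+1)` one at period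
`N` is odd under the slot inversion with centre `c^N_t = N•t + (N−1)•𝟙` (§1's column read ⨾ `colH_pointInv_ctr_gen` with centre vector `c^N_t`, `Lc•c^N_t + (Lc−1)•𝟙 = c^{Lc·N}_t`
⨾ re-indexing `u ↦ c^{Lc·N}_t − e_κ − u` ⨾ the hypothesis). -/
theorem exitCharge_pointInv_succ (hLc : Odd Lc) (cE cVH cΛ : ℝ) (j : ℕ) (α β : Fin (d + 1)) {N : ℕ} (hN : 1 ≤ N) (t : Site (d + 1))
    (ih : ∀ (κ : Fin (d + 1)) (u : Site (d + 1)),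
      ∑' xz : Site (d + 1) × Site (d + 1),
          (if xz.1 α % ((Lc * N : ℕ) : ℤ) = ((Lc * N : ℕ) : ℤ) - 1 then (1 : ℝ) else 0) * (if xz.2 β % ((Lc * N : ℕ) : ℤ) = ((Lc * N : ℕ) : ℤ) - 1 then (1 : ℝ) else 0)
            * SpureRecAt d Lc (toSite (ctrOff (d + 1) Lc)) cE cVH cΛ j κ
              (((Lc * N : ℕ) : ℤ) • t + (fun _ : Fin (d + 1) => ((Lc * N : ℕ) : ℤ) - 1) - unitVec κ - u) xz.1 xz.2 (Sum.inl α) (Sum.inl β)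
        = -∑' xz : Site (d + 1) × Site (d + 1),
          (if xz.1 α % ((Lc * N : ℕ) : ℤ) = ((Lc * N : ℕ) : ℤ) - 1 then (1 : ℝ) else 0) * (if xz.2 β % ((Lc * N : ℕ) : ℤ) = ((Lc * N : ℕ) : ℤ) - 1 then (1 : ℝ) else 0)
            * SpureRecAt d Lc (toSite (ctrOff (d + 1) Lc)) cE cVH cΛ j κ u xz.1 xz.2 (Sum.inl α) (Sum.inl β))
    (κ' : Fin (d + 1)) (u' : Site (d + 1)) :
    ∑' xz : Site (d + 1) × Site (d + 1),
        (if xz.1 α % (N : ℤ) = (N : ℤ) - 1 then (1 : ℝ) else 0) * (if xz.2 β % (N : ℤ) = (N : ℤ) - 1 then (1 : ℝ) else 0)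
          * SpureRecAt d Lc (toSite (ctrOff (d + 1) Lc)) cE cVH cΛ (j + 1) κ'
            ((N : ℤ) • t + (fun _ : Fin (d + 1) => (N : ℤ) - 1) - unitVec κ' - u') xz.1 xz.2 (Sum.inl α) (Sum.inl β)
      = -∑' xz : Site (d + 1) × Site (d + 1),
        (if xz.1 α % (N : ℤ) = (N : ℤ) - 1 then (1 : ℝ) else 0) * (if xz.2 β % (N : ℤ) = (N : ℤ) - 1 then (1 : ℝ) else 0)
          * SpureRecAt d Lc (toSite (ctrOff (d + 1) Lc)) cE cVH cΛ (j + 1) κ' u' xz.1 xz.2 (Sum.inl α) (Sum.inl β) := by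
  classical
  have hLc1 : 1 ≤ Lc := hLc.pos
  have hr : ctrOff (d + 1) Lc ∈ box (d + 1) Lc := ctrOff_mem_box hLc1
  -- the slot centre vector and the leg centre one level down
  set c : Site (d + 1) := (N : ℤ) • t + (fun _ : Fin (d + 1) => (N : ℤ) - 1) with hc
  have eslot : ((N : ℤ) • t + (fun _ : Fin (d + 1) => (N : ℤ) - 1) - unitVec κ' - u' : Site (d + 1)) = c - Pi.single κ' 1 - u' := rfl
  have ec : ((Lc : ℤ) • c + toSite (fun _ : Fin (d + 1) => Lc - 1) : Site (d + 1))
      = ((Lc * N : ℕ) : ℤ) • t + (fun _ : Fin (d + 1) => ((Lc * N : ℕ) : ℤ) - 1) := by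
    funext i
    simp only [hc, Pi.add_apply, Pi.smul_apply, smul_eq_mul, toSite, Nat.cast_sub hLc1, Nat.cast_one, Nat.cast_mul]
    ring
  rw [eslot, exitCharge_succ_eq_colH_read hr cE cVH cΛ j α β hN κ' (c - Pi.single κ' 1 - u'), exitCharge_succ_eq_colH_read hr cE cVH cΛ j α β hN κ' u',
    ← mul_neg, ← mul_neg, ← Finset.sum_neg_distrib]
  refine congrArg (fun X => (cE * wE d Lc (j + 1)) * (((stepScale d Lc j * (Lc : ℝ) ^ (d + 1))⁻¹ ^ 2) * X)) ?_
  refine Finset.sum_congr rfl fun κ _ => ?_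
  rw [← tsum_neg]
  -- move the inversion from the slot onto the leg, then re-index the leg
  let E : Site (d + 1) ≃ Site (d + 1) := Equiv.subLeft (((Lc : ℤ) • c + toSite (fun _ : Fin (d + 1) => Lc - 1) - Pi.single κ 1 : Site (d + 1)))
  refine ((E.tsum_eq _).symm.trans ?_)
  refine tsum_congr fun u => ?_
  simp only [E, Equiv.subLeft_apply]
  rw [colH_pointInv_ctr_gen (d := d) hLc j c κ' u' κ u]
  have eleg : ((Lc : ℤ) • c + toSite (fun _ : Fin (d + 1) => Lc - 1) - Pi.single κ 1 - u : Site (d + 1))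
      = ((Lc * N : ℕ) : ℤ) • t + (fun _ : Fin (d + 1) => ((Lc * N : ℕ) : ℤ) - 1) - unitVec κ - u := by
    rw [ec]; rfl
  rw [eleg, ih κ u, mul_neg]

/-! ## §2 The induction: every level, every period, every centre -/

/-- NOT IN PRINT; OUR BOOKKEEPING.  **THE PARITY TOWER** (centred root, `Lc` odd, all `cE cVH cΛ`, ALL `α β`): for EVERY level `j`, EVERY `N ≥ 1`, every integer vector `t` and every
slot `(κ, u)`, the exit⊗exit charge function of `SpureRecAt … j` at period `Lc·N` is ODD under the slot inversion with centre `(Lc·N)•t + (Lc·N − 1)•𝟙`: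
`C^{Lc·N}_j(κ, c − e_κ − u) = −C^{Lc·N}_j(κ, u)` (induction on `j` with `N ↦ Lc·N` in the hypothesis; base `ExitChargeParityBase.exitCharge_spureRecAt_zero_pointInv`, rung §1). -/
theorem exitCharge_spureRecAt_pointInv (hLc : Odd Lc) (cE cVH cΛ : ℝ) (α β : Fin (d + 1)) :
    ∀ (j N : ℕ), 1 ≤ N → ∀ (t : Site (d + 1)) (κ : Fin (d + 1)) (u : Site (d + 1)),
      ∑' xz : Site (d + 1) × Site (d + 1),
          (if xz.1 α % ((Lc * N : ℕ) : ℤ) = ((Lc * N : ℕ) : ℤ) - 1 then (1 : ℝ) else 0) * (if xz.2 β % ((Lc * N : ℕ) : ℤ) = ((Lc * N : ℕ) : ℤ) - 1 then (1 : ℝ) else 0)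
            * SpureRecAt d Lc (toSite (ctrOff (d + 1) Lc)) cE cVH cΛ j κ
              (((Lc * N : ℕ) : ℤ) • t + (fun _ : Fin (d + 1) => ((Lc * N : ℕ) : ℤ) - 1) - unitVec κ - u) xz.1 xz.2 (Sum.inl α) (Sum.inl β)
        = -∑' xz : Site (d + 1) × Site (d + 1),
          (if xz.1 α % ((Lc * N : ℕ) : ℤ) = ((Lc * N : ℕ) : ℤ) - 1 then (1 : ℝ) else 0) * (if xz.2 β % ((Lc * N : ℕ) : ℤ) = ((Lc * N : ℕ) : ℤ) - 1 then (1 : ℝ) else 0)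
            * SpureRecAt d Lc (toSite (ctrOff (d + 1) Lc)) cE cVH cΛ j κ u xz.1 xz.2 (Sum.inl α) (Sum.inl β)
  | 0, _, hN, t, κ, u => exitCharge_spureRecAt_zero_pointInv (ctrOff_mem_box hLc.pos) cE cVH cΛ α β hN t κ u
  | j + 1, N, hN, t, κ, u => by
    have hLN : 1 ≤ Lc * N := Nat.one_le_iff_ne_zero.2 (Nat.mul_ne_zero (NeZero.ne Lc) (by omega))
    exact exitCharge_pointInv_succ hLc cE cVH cΛ j α β hLN t
      (fun κ₁ u₁ => exitCharge_spureRecAt_pointInv hLc cE cVH cΛ α β j (Lc * N) hLN t κ₁ u₁) κ u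

/-- NOT IN PRINT; OUR BOOKKEEPING.  **THE PARITY TOWER AT LEVELS `≥ 1`, EVERY PERIOD** (centred root, `Lc` odd, all `cE cVH cΛ`, ALL `α β`, every `j`, EVERY `N ≥ 1` — `N = Lc` is the
pure exit class of the (S) row, `N = 1` the plain class —, every `t`, every slot): `C^N_{j+1}(κ, N•t + (N−1)•𝟙 − e_κ − u) = −C^N_{j+1}(κ, u)` (§1 on §2 at period `Lc·N`). -/
theorem exitCharge_spureRecAt_succ_pointInv (hLc : Odd Lc) (cE cVH cΛ : ℝ) (α β : Fin (d + 1)) (j : ℕ) {N : ℕ} (hN : 1 ≤ N) (t : Site (d + 1))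
    (κ : Fin (d + 1)) (u : Site (d + 1)) :
    ∑' xz : Site (d + 1) × Site (d + 1),
        (if xz.1 α % (N : ℤ) = (N : ℤ) - 1 then (1 : ℝ) else 0) * (if xz.2 β % (N : ℤ) = (N : ℤ) - 1 then (1 : ℝ) else 0)
          * SpureRecAt d Lc (toSite (ctrOff (d + 1) Lc)) cE cVH cΛ (j + 1) κ
            ((N : ℤ) • t + (fun _ : Fin (d + 1) => (N : ℤ) - 1) - unitVec κ - u) xz.1 xz.2 (Sum.inl α) (Sum.inl β)
      = -∑' xz : Site (d + 1) × Site (d + 1),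
        (if xz.1 α % (N : ℤ) = (N : ℤ) - 1 then (1 : ℝ) else 0) * (if xz.2 β % (N : ℤ) = (N : ℤ) - 1 then (1 : ℝ) else 0)
          * SpureRecAt d Lc (toSite (ctrOff (d + 1) Lc)) cE cVH cΛ (j + 1) κ u xz.1 xz.2 (Sum.inl α) (Sum.inl β) :=
  exitCharge_pointInv_succ hLc cE cVH cΛ j α β hN t (fun κ₁ u₁ => exitCharge_spureRecAt_pointInv hLc cE cVH cΛ α β j N hN t κ₁ u₁) κ u

/-- NOT IN PRINT; OUR BOOKKEEPING.  **THE PURE EXIT CLASS AT EVERY LEVEL INCLUDING `j = 0`** (centred root, `Lc` odd, all `cE cVH cΛ`, ALL `α β`, every `t`, every slot): with the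
plain exit weights `𝟙^{exit,Lc}`, `C^{Lc}_j(κ, Lc•t + (Lc−1)•𝟙 − e_κ − u) = −C^{Lc}_j(κ, u)` (§2 at `N = 1`; the jb = 0 member serves leaf-06 g47's level-0 (γ) files). -/
theorem exitCharge_spureRecAt_pointInv_exit (hLc : Odd Lc) (cE cVH cΛ : ℝ) (α β : Fin (d + 1)) (j : ℕ) (t : Site (d + 1)) (κ : Fin (d + 1)) (u : Site (d + 1)) :
    ∑' xz : Site (d + 1) × Site (d + 1),
        (if xz.1 α % (Lc : ℤ) = (Lc : ℤ) - 1 then (1 : ℝ) else 0) * (if xz.2 β % (Lc : ℤ) = (Lc : ℤ) - 1 then (1 : ℝ) else 0)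
          * SpureRecAt d Lc (toSite (ctrOff (d + 1) Lc)) cE cVH cΛ j κ
            ((Lc : ℤ) • t + (fun _ : Fin (d + 1) => (Lc : ℤ) - 1) - unitVec κ - u) xz.1 xz.2 (Sum.inl α) (Sum.inl β)
      = -∑' xz : Site (d + 1) × Site (d + 1),
        (if xz.1 α % (Lc : ℤ) = (Lc : ℤ) - 1 then (1 : ℝ) else 0) * (if xz.2 β % (Lc : ℤ) = (Lc : ℤ) - 1 then (1 : ℝ) else 0)
          * SpureRecAt d Lc (toSite (ctrOff (d + 1) Lc)) cE cVH cΛ j κ u xz.1 xz.2 (Sum.inl α) (Sum.inl β) := by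
  have h := exitCharge_spureRecAt_pointInv hLc cE cVH cΛ α β j 1 le_rfl t κ u
  simpa only [Nat.mul_one] using h

/-! ## §3 The consumer: road-P2's `hZS` for the exit class, and (INV-X-geo) at the centred root with no displayed hypothesis -/

/-- NOT IN PRINT; OUR BOOKKEEPING.  **ROAD-P2 g39's `hZS` AT THE CENTRED ROOT FOR THE CONSUMER's CLASS** (`Lc` odd, all `cE cVH cΛ`, every `j`, label `y`, channel `(inl κ₀, inl κ₀′)`,
coefficients `p₁ p₂` — e.g. `p₁ = p₂ = Lc⁻²` for the transported currency `u ⊗ u`): with `ω(x,z) := (if x_{κ₀} % Lc = Lc−1 then p₁ else 0)·(if z_{κ₀′} % Lc = Lc−1 then p₂ else 0)`,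
`Σ' ω·SpureRecAt … (j+1) κ (c_y − e_κ − u) x z (inl κ₀)(inl κ₀′) = (−1)·Σ' ω·SpureRecAt … (j+1) κ u x z (inl κ₀)(inl κ₀′)`, `c_y = Lc•(2•y) + (Lc−1)•𝟙` — §2 at `N = Lc`,
`t = 2•y`; `t_κ = −1`, `ω′ = ω` (road-P2 E26: «t = −1»). -/
theorem tsum_exitWt_spureRecAt_slotInv_ctr (hLc : Odd Lc) (cE cVH cΛ : ℝ) (j : ℕ) (y : Site (d + 1)) (κ₀ κ₀' : Fin (d + 1)) (p₁ p₂ : ℝ)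
    (κ : Fin (d + 1)) (u : Site (d + 1)) :
    ∑' xz : Site (d + 1) × Site (d + 1),
        ((if xz.1 κ₀ % (Lc : ℤ) = (Lc : ℤ) - 1 then p₁ else 0) * (if xz.2 κ₀' % (Lc : ℤ) = (Lc : ℤ) - 1 then p₂ else 0))
          * SpureRecAt d Lc (toSite (ctrOff (d + 1) Lc)) cE cVH cΛ (j + 1) κ
            ((Lc : ℤ) • ((2 : ℕ) • y) + toSite (fun _ : Fin (d + 1) => Lc - 1) - Pi.single κ 1 - u) xz.1 xz.2 (Sum.inl κ₀) (Sum.inl κ₀')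
      = (-1) * ∑' xz : Site (d + 1) × Site (d + 1),
        ((if xz.1 κ₀ % (Lc : ℤ) = (Lc : ℤ) - 1 then p₁ else 0) * (if xz.2 κ₀' % (Lc : ℤ) = (Lc : ℤ) - 1 then p₂ else 0))
          * SpureRecAt d Lc (toSite (ctrOff (d + 1) Lc)) cE cVH cΛ (j + 1) κ u xz.1 xz.2 (Sum.inl κ₀) (Sum.inl κ₀') := by
  have hLc1 : 1 ≤ Lc := hLc.pos
  -- the coefficients factor out of the indicators
  have ew : ∀ xz : Site (d + 1) × Site (d + 1),
      (if xz.1 κ₀ % (Lc : ℤ) = (Lc : ℤ) - 1 then p₁ else 0) * (if xz.2 κ₀' % (Lc : ℤ) = (Lc : ℤ) - 1 then p₂ else 0)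
        = (p₁ * p₂) * ((if xz.1 κ₀ % (Lc : ℤ) = (Lc : ℤ) - 1 then (1 : ℝ) else 0) * (if xz.2 κ₀' % (Lc : ℤ) = (Lc : ℤ) - 1 then (1 : ℝ) else 0)) := fun xz => by
    split_ifs <;> ring
  have ec : ((Lc : ℤ) • ((2 : ℕ) • y) + toSite (fun _ : Fin (d + 1) => Lc - 1) - Pi.single κ 1 - u : Site (d + 1))
      = (Lc : ℤ) • ((2 : ℕ) • y) + (fun _ : Fin (d + 1) => (Lc : ℤ) - 1) - unitVec κ - u := by
    funext i
    simp only [Pi.add_apply, Pi.sub_apply, Pi.smul_apply, smul_eq_mul, toSite, Nat.cast_sub hLc1, Nat.cast_one, AffineAveraging.unitVec]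
  simp only [ew, mul_assoc, tsum_mul_left]
  rw [ec]
  have h := exitCharge_spureRecAt_succ_pointInv hLc cE cVH cΛ κ₀ κ₀' j (N := Lc) hLc1 ((2 : ℕ) • y) κ u
  simp only [mul_assoc] at h
  rw [h]
  ring

/-- NOT IN PRINT; OUR BOOKKEEPING.  **(INV-X-geo) AT THE CENTRED ROOT IN THE (S) ROW's CURRENCY, NO DISPLAYED HYPOTHESIS — CHARGE FORM** (`Lc` odd, all `cE cVH cΛ`, every `j`, label
`y`, slot direction `ν`, channel `(inl κ₀, inl κ₀′)`, coefficients `p₁ p₂`): if the ω-charge of the END-POINT rotated vertex `(α⁺)_y` at the slot `(ν, y′)` is `v`, then the ω-charge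
of `(α)_y` at the inverted slot `(ν, 2•y − e_ν − y′)` is `−v` — road-P2 g39's `weightedCharge_rotatedVertex_slotInv` with (INV-G) (`CoDressedColumnPointInversion`), `hZM`
(`ConstraintHessianPointInversion`) AND `hZS` (§3) all discharged; `ε = −1`. -/
theorem weightedCharge_rotatedVertex_slotInv_ctr_exit (hLc : Odd Lc) (cE cVH cΛ : ℝ) (j : ℕ) (y : Site (d + 1)) (ν κ₀ κ₀' : Fin (d + 1)) (p₁ p₂ : ℝ)
    (y' : Site (d + 1)) {v : ℝ}
    (hv : HasSum (fun xz : Site (d + 1) × Site (d + 1) =>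
        ((if xz.1 κ₀ % (Lc : ℤ) = (Lc : ℤ) - 1 then p₁ else 0) * (if xz.2 κ₀' % (Lc : ℤ) = (Lc : ℤ) - 1 then p₂ else 0)) *
        ((1 / 2 : ℝ) • dM (conjV (coDressKBmAt (toSite (ctrOff (d + 1) Lc)) Lc (KInvStep (d := d) Lc (j + 1))) (diagK (fun z c =>
            (((1 : ℝ) / 2) • ∑ v ∈ box (d + 1) Lc, legInd (toSite (ctrOff (d + 1) Lc)) ((Lc : ℤ) • y + toSite v))
              (z + Sum.elim (fun κ => (Pi.single κ 1 : Site (d + 1))) (fun μ => (Lc : ℤ) • (Pi.single μ 1 : Site (d + 1))) c) c))) Lc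
          (SpureRecAt d Lc (toSite (ctrOff (d + 1) Lc)) cE cVH cΛ (j + 1)) (M1At d Lc (toSite (ctrOff (d + 1) Lc)) cΛ (j + 1)) ν y') xz.1 xz.2
          (Sum.inl κ₀) (Sum.inl κ₀')) v) :
    HasSum (fun xz : Site (d + 1) × Site (d + 1) =>
        ((if xz.1 κ₀ % (Lc : ℤ) = (Lc : ℤ) - 1 then p₁ else 0) * (if xz.2 κ₀' % (Lc : ℤ) = (Lc : ℤ) - 1 then p₂ else 0)) *
        ((1 / 2 : ℝ) • dM (conjV (coDressKBmAt (toSite (ctrOff (d + 1) Lc)) Lc (KInvStep (d := d) Lc (j + 1)))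
            (diagK (((1 : ℝ) / 2) • ∑ v ∈ box (d + 1) Lc, legInd (toSite (ctrOff (d + 1) Lc)) ((Lc : ℤ) • y + toSite v)))) Lc
          (SpureRecAt d Lc (toSite (ctrOff (d + 1) Lc)) cE cVH cΛ (j + 1)) (M1At d Lc (toSite (ctrOff (d + 1) Lc)) cΛ (j + 1)) ν
          ((2 : ℕ) • y - Pi.single ν 1 - y')) xz.1 xz.2 (Sum.inl κ₀) (Sum.inl κ₀'))
      ((-1) * v) :=
  weightedCharge_rotatedVertex_slotInv_ctr_spanExit hLc cE cVH cΛ j y ν κ₀ κ₀' p₁ 0 p₂ 0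
    (fun κ u => tsum_exitWt_spureRecAt_slotInv_ctr hLc cE cVH cΛ j y κ₀ κ₀' p₁ p₂ κ u) y' hv

/-- NOT IN PRINT; OUR BOOKKEEPING.  **(INV-X-geo) AT THE CENTRED ROOT, NO DISPLAYED HYPOTHESIS — PROFILE FORM** (same data): road-P2 g39's `weightedProfile_comb_slotInv` for the exit
class with (INV-G), `hZM`, `hZS` all discharged: `V^{base}_{Z_ω}(ν, 2•y − e_ν − y′) = −V^{end}_{Z_ω}(ν, y′)`. -/
theorem weightedProfile_comb_slotInv_ctr_exit (hLc : Odd Lc) (cE cVH cΛ : ℝ) (j : ℕ) (y : Site (d + 1)) (ν κ₀ κ₀' : Fin (d + 1)) (p₁ p₂ : ℝ) (y' : Site (d + 1)) :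
    (1 / 2 : ℝ) *
        ((∑ κ : Fin (d + 1), ∑' u : Site (d + 1),
            colH (coDressKBmAt (toSite (ctrOff (d + 1) Lc)) Lc (KInvStep (d := d) Lc (j + 1))) Lc ν ((2 : ℕ) • y - Pi.single ν 1 - y') κ u
              * ((if (2 : ℕ) • y - Pi.single ν 1 - y' = y then (1 / 2 : ℝ) else 0) - (if blk Lc u = y then (1 / 2 : ℝ) else 0))
              * ∑' xz : Site (d + 1) × Site (d + 1),
                  ((if xz.1 κ₀ % (Lc : ℤ) = (Lc : ℤ) - 1 then p₁ else 0) * (if xz.2 κ₀' % (Lc : ℤ) = (Lc : ℤ) - 1 then p₂ else 0))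
                    * SpureRecAt d Lc (toSite (ctrOff (d + 1) Lc)) cE cVH cΛ (j + 1) κ u xz.1 xz.2 (Sum.inl κ₀) (Sum.inl κ₀'))
          + ∑ ρ' : Fin (d + 1), ∑' w : Site (d + 1),
            colM (coDressKBmAt (toSite (ctrOff (d + 1) Lc)) Lc (KInvStep (d := d) Lc (j + 1))) Lc ν ((2 : ℕ) • y - Pi.single ν 1 - y') ρ' w
              * ((if (2 : ℕ) • y - Pi.single ν 1 - y' = y then (1 / 2 : ℝ) else 0) - (if w = y then (1 / 2 : ℝ) else 0))
              * ∑' xz : Site (d + 1) × Site (d + 1),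
                  ((if xz.1 κ₀ % (Lc : ℤ) = (Lc : ℤ) - 1 then p₁ else 0) * (if xz.2 κ₀' % (Lc : ℤ) = (Lc : ℤ) - 1 then p₂ else 0))
                    * M1At d Lc (toSite (ctrOff (d + 1) Lc)) cΛ (j + 1) ρ' w xz.1 xz.2 (Sum.inl κ₀) (Sum.inl κ₀'))
      = (-1) * ((1 / 2 : ℝ) *
        ((∑ κ : Fin (d + 1), ∑' u : Site (d + 1),
            colH (coDressKBmAt (toSite (ctrOff (d + 1) Lc)) Lc (KInvStep (d := d) Lc (j + 1))) Lc ν y' κ u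
              * ((if y' + Pi.single ν 1 = y then (1 / 2 : ℝ) else 0) - (if blk Lc (u + Pi.single κ 1) = y then (1 / 2 : ℝ) else 0))
              * ∑' xz : Site (d + 1) × Site (d + 1),
                  ((if xz.1 κ₀ % (Lc : ℤ) = (Lc : ℤ) - 1 then p₁ else 0) * (if xz.2 κ₀' % (Lc : ℤ) = (Lc : ℤ) - 1 then p₂ else 0))
                    * SpureRecAt d Lc (toSite (ctrOff (d + 1) Lc)) cE cVH cΛ (j + 1) κ u xz.1 xz.2 (Sum.inl κ₀) (Sum.inl κ₀'))
          + ∑ ρ' : Fin (d + 1), ∑' w : Site (d + 1),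
            colM (coDressKBmAt (toSite (ctrOff (d + 1) Lc)) Lc (KInvStep (d := d) Lc (j + 1))) Lc ν y' ρ' w
              * ((if y' + Pi.single ν 1 = y then (1 / 2 : ℝ) else 0) - (if w + Pi.single ρ' 1 = y then (1 / 2 : ℝ) else 0))
              * ∑' xz : Site (d + 1) × Site (d + 1),
                  ((if xz.1 κ₀ % (Lc : ℤ) = (Lc : ℤ) - 1 then p₁ else 0) * (if xz.2 κ₀' % (Lc : ℤ) = (Lc : ℤ) - 1 then p₂ else 0))
                    * M1At d Lc (toSite (ctrOff (d + 1) Lc)) cΛ (j + 1) ρ' w xz.1 xz.2 (Sum.inl κ₀) (Sum.inl κ₀'))) :=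
  weightedProfile_comb_slotInv_ctr_spanExit hLc cE cVH cΛ j y ν κ₀ κ₀' p₁ 0 p₂ 0
    (fun κ u => tsum_exitWt_spureRecAt_slotInv_ctr hLc cE cVH cΛ j y κ₀ κ₀' p₁ p₂ κ u) y'

/-- NOT IN PRINT; OUR BOOKKEEPING.  **(INV-X-geo) AS THE PROFILE IDENTITY `hgeo` OF ROAD-P2's `tsum_slotMoment_pair_eq_zero`** (centred root, `Lc` odd, all `cE cVH cΛ`, every `j`,
label `y`, slot direction `ν`, channel `(inl κ₀, inl κ₀′)`, coefficients `p₁ p₂`; NO displayed hypothesis): in `tsum` form,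
`Σ' ω·(α)_y-charge at (ν, 2•y − e_ν − y′) = (−1)·Σ' ω·(α⁺)_y-charge at (ν, y′)` — i.e. `Vα (2•y − e_ν − y′) = ε·V⁺ y′` with `ε = −1` for the profiles `Vα y″ := Σ' ω·(α)(ν,y″)`,
`V⁺ y′ := Σ' ω·(α⁺)(ν,y′)` (the (α⁺) family is summable by road-P2's `hasSum_weighted_rotatedVertexEnd_comb`, `|ω| ≤ |p₁|·|p₂|`). -/
theorem tsum_weightedCharge_rotatedVertex_slotInv_ctr_exit (hLc : Odd Lc) (cE cVH cΛ : ℝ) (j : ℕ) (y : Site (d + 1)) (ν κ₀ κ₀' : Fin (d + 1)) (p₁ p₂ : ℝ)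
    (y' : Site (d + 1)) :
    ∑' xz : Site (d + 1) × Site (d + 1),
        ((if xz.1 κ₀ % (Lc : ℤ) = (Lc : ℤ) - 1 then p₁ else 0) * (if xz.2 κ₀' % (Lc : ℤ) = (Lc : ℤ) - 1 then p₂ else 0)) *
        ((1 / 2 : ℝ) • dM (conjV (coDressKBmAt (toSite (ctrOff (d + 1) Lc)) Lc (KInvStep (d := d) Lc (j + 1)))
            (diagK (((1 : ℝ) / 2) • ∑ v ∈ box (d + 1) Lc, legInd (toSite (ctrOff (d + 1) Lc)) ((Lc : ℤ) • y + toSite v)))) Lc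
          (SpureRecAt d Lc (toSite (ctrOff (d + 1) Lc)) cE cVH cΛ (j + 1)) (M1At d Lc (toSite (ctrOff (d + 1) Lc)) cΛ (j + 1)) ν
          ((2 : ℕ) • y - Pi.single ν 1 - y')) xz.1 xz.2 (Sum.inl κ₀) (Sum.inl κ₀')
      = (-1) * ∑' xz : Site (d + 1) × Site (d + 1),
        ((if xz.1 κ₀ % (Lc : ℤ) = (Lc : ℤ) - 1 then p₁ else 0) * (if xz.2 κ₀' % (Lc : ℤ) = (Lc : ℤ) - 1 then p₂ else 0)) *
        ((1 / 2 : ℝ) • dM (conjV (coDressKBmAt (toSite (ctrOff (d + 1) Lc)) Lc (KInvStep (d := d) Lc (j + 1))) (diagK (fun z c =>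
            (((1 : ℝ) / 2) • ∑ v ∈ box (d + 1) Lc, legInd (toSite (ctrOff (d + 1) Lc)) ((Lc : ℤ) • y + toSite v))
              (z + Sum.elim (fun κ => (Pi.single κ 1 : Site (d + 1))) (fun μ => (Lc : ℤ) • (Pi.single μ 1 : Site (d + 1))) c) c))) Lc
          (SpureRecAt d Lc (toSite (ctrOff (d + 1) Lc)) cE cVH cΛ (j + 1)) (M1At d Lc (toSite (ctrOff (d + 1) Lc)) cΛ (j + 1)) ν y') xz.1 xz.2
          (Sum.inl κ₀) (Sum.inl κ₀') := by
  have hω : ∀ xz : Site (d + 1) × Site (d + 1),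
      |(if xz.1 κ₀ % (Lc : ℤ) = (Lc : ℤ) - 1 then p₁ else 0) * (if xz.2 κ₀' % (Lc : ℤ) = (Lc : ℤ) - 1 then p₂ else 0)| ≤ |p₁| * |p₂| := fun xz => by
    rw [abs_mul]
    refine mul_le_mul ?_ ?_ (abs_nonneg _) (abs_nonneg _)
    · split_ifs
      · exact le_rfl
      · rw [abs_zero]; exact abs_nonneg _
    · split_ifs
      · exact le_rfl
      · rw [abs_zero]; exact abs_nonneg _
  have hend := hasSum_weighted_rotatedVertexEnd_comb hLc.pos (ctrOff_mem_box hLc.pos) cE cVH cΛ j y ν y' (Sum.inl κ₀) (Sum.inl κ₀') hω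
  rw [(weightedCharge_rotatedVertex_slotInv_ctr_exit hLc cE cVH cΛ j y ν κ₀ κ₀' p₁ p₂ y' hend).tsum_eq, hend.tsum_eq]

end Summit.QuantumFields.BalabanUV.Beta.GAN24.ExitChargeParityTower

end
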